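import Summits.ValiantsHypothesis.ValiantsHypothesis.Theorems.NewtonUnitEquationsTwoProductsRankOneAPLawSlice
import HarnessLib

/-!
# Route NewtonUnitEquations — crux `TwoProducts` (stmt-ValiantsHypothesis-5906), line `relation_ladder`, rung R6c (three-term
# rank one, arithmetic-progression shape `2β = α + γ`): the VERONESE LIFT — part 3/5 — the planar instance: AP relation data, exponent doubling inside the push-forward, injectivity, lifted visible points (Part V4)

val-lit-p3 g15 (prover seat, helper mode `--supports stmt-ValiantsHypothesis-5906 --as helper`), 2026-08-28.  Rung R6c of val-idea-8's line
`relation_ladder` (card `Lines/relation_ladder.md` v14 l.28–35; engine memo `Lines/relation_ladder_R6_engine.md` rev 3 §7′: «`2β = α + γ` (3-AP,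
`ρ⁺ = {β,β}`): Veronese `X_α ↦ Z², X_β ↦ ZW, X_γ ↦ W²` after DOUBLING all planar exponents»).  THE THREE-TERM ARITHMETIC-PROGRESSION RANK-ONE
LAW: if ALL additive coincidences of the letter family `A_j = supp u_j ∪ supp v_j` come from ONE relation `α + γ = β + β` among DISTINCT
letters (`RankOneCoincidences A (2·e_β) (e_α + e_γ)`), then GLOBALLY `#visible ≤ 2^{c m} (#T + 2)^c` — the statement shape of R3♯
`permTypeLaw_proof` / R6 `rankOneFourLaw_proof` / R6b `R6b.rankOneThreeLaw_proof`.  MECHANISM: the VERONESE LIFT realises the toric ring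
`ℂ[Y]/(Y_β² − Y_αY_γ)` inside a FREE ring (variables `Z = Y_a`, `W = Y_c`, `Y_b` dead); the planar push-forward `Z ↦ α, W ↦ γ, Y_e ↦ 2e`
DOUBLES every planar exponent INSIDE the push-forward (`phi E' ∘ φ_ver = doubling ∘ phi enum`), so the instance `(u, v)` is never changed and
`ℕ²`-integrality is automatic; rank-one coincidences = injectivity on the lifted support (one level up from R3♯'s `injOn_of_permType`); Lemma A
upstairs = the tree's `toric_minLog`; the fibre of the lift over a balanced exponent is `{#β = k : k ≡ x_Z (mod 2), k ≤ min(x_Z, x_W)}` with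
CONSTANT letter count, and the multinomial regroups as `multinomial(x̂)·C(h,(x_W+k)/2)·C((x_W+k)/2,k)` in the HALF-DEGREE `h = (x_Z+x_W)/2` —
so with the reduced exponent `x̂ = (h @ Z, 0 @ Y_b, 0 @ W, rest)` every slice `b = x_W ≤ 2m` is a plain BINOMIAL-EXPONENTIAL sum of width
`≤ 2m(2m+1)²` (no parity bases, no square roots), counted by val-lit-p3 g14's tool `BinExpSum.binExpPencilCount` (p620797) through the landed
`binExpPencilCount_fintype`; the slice identity `θ(x) = 2·Σ_i (−wt ξ ŝ_i) x̂_i + (Γ − A)·x_W` makes the slice functional affine along the pencil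
of valid weights; degenerate case (a relation letter outside the alphabet) via R3♯.  All statements are by LITERAL body (no parameter-free
`def … : Prop`); generic toolkit (`phiT/piT`, `binChar/bsum/bwidth`, `toric_minLog`, `RankOneCoincidences`, `idxOf`, `rW`, `lwt_*`, `SIdx/tab/sgn`)
and the three-index API (`R6b.ThreeIdx`, `R6b.rest`, `R6b.prod_three_split`, …) are IMPORTED from the landed R6 / R6b ports, not re-declared.
Honest scope: helper layer; nothing here closes the residual of the line, the crux `TwoProducts` (5906) or `VP ≠ VNP`; no summit statement is
proved. [folklore]
-/

noncomputable section

-- Sub = Summit single-conjunct layout: the duplicated namespace component is mandated by the tree.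
set_option linter.dupNamespace false
set_option linter.unusedSimpArgs false

namespace Summit.ValiantsHypothesis.ValiantsHypothesis.Theorems.NewtonUnitEquations.TwoProducts.PermutationType
namespace R6c
open scoped BigOperators
open MvPolynomial

variable {σ : Type*} [Fintype σ] [DecidableEq σ]

variable (J : R6b.ThreeIdx σ)

/-! ## Part V4: the planar instance — three-term relation data, exponent DOUBLING, the planar push-forward `E'`
(`Z ↦ α`, `W ↦ γ`, `Y_e ↦ 2e`), injectivity from rank-one coincidences, lifted visible points -/

section VeronesePlanar
open Summit.ValiantsHypothesis.ValiantsHypothesis.Theorems.NewtonUnitEquations.TwoProducts.FormalLogLinearisation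
open Summit.ValiantsHypothesis.ValiantsHypothesis.Theorems.NewtonUnitEquations.TwoProducts.PlanarCell

variable {m : ℕ}

omit [Fintype σ] [DecidableEq σ] in
/-- Rank-one coincidences do not depend on the orientation of the relation. [folklore] -/
theorem rankOneCoincidences_symm (A : Fin m → Finset Expo) (ρp ρm : Expo →₀ ℕ)
    (h : RankOneCoincidences A ρp ρm) : RankOneCoincidences A ρm ρp := by
  intro a ha b hb hab
  obtain ⟨k, hk⟩ := h a ha b hb hab
  rcases hk with hk | hk
  · exact ⟨k, Or.inr hk.symm⟩
  · exact ⟨k, Or.inl hk.symm⟩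

omit [Fintype σ] [DecidableEq σ] in
/-- **Degenerate relations.** If one of the three relation letters is absent from the family, rank-one coincidences for
the three-term relation `α + γ = 2β` are already of permutation type. [folklore] -/
theorem permType_of_absent_letter3 (A : Fin m → Finset Expo) (α β γ : Expo) (hab : α ≠ β) (hac : α ≠ γ) (hbc : β ≠ γ)
    (hR : RankOneCoincidences A (Finsupp.single β 2) (Finsupp.single α 1 + Finsupp.single γ 1))
    (e : Expo) (he : e = α ∨ e = β ∨ e = γ) (hnot : ∀ j, e ∉ A j) : PermType A := by
  intro a ha b hb hab'
  obtain ⟨k, hk⟩ := hR a ha b hb hab'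
  have ha0 := msetT_apply_eq_zero A a ha e hnot
  have hb0 := msetT_apply_eq_zero A b hb e hnot
  have hk0 : k = 0 := by
    rcases hk with hk | hk <;>
    · have h1 := DFunLike.congr_fun hk e
      simp only [Finsupp.add_apply, Finsupp.smul_apply, smul_eq_mul, Finsupp.single_apply, ha0, hb0] at h1
      rcases he with rfl | rfl | rfl <;>
        simp [hab, hac, hbc, hab.symm, hac.symm, hbc.symm] at h1 <;> omega
  subst hk0
  simp only [zero_smul, add_zero] at hk
  rcases hk with hk | hk
  · exact hk
  · exact hk.symm

omit [Fintype σ] [DecidableEq σ] in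
/-- Doubling is injective on exponent vectors. [folklore] -/
theorem two_nsmul_inj_expo (a b : Expo) (h : 2 • a = 2 • b) : a = b := by
  ext k
  have := DFunLike.congr_fun h k
  simp only [Finsupp.coe_smul, Pi.smul_apply, smul_eq_mul] at this
  omega

/-- The doubling substitution `X_k ↦ X_k²` on letters. [folklore] -/
def dblM : Fin 2 → Expo := fun k => Finsupp.single k 2

omit [Fintype σ] [DecidableEq σ] in
/-- On exponents the doubling substitution is `l ↦ 2l`. [folklore] -/
theorem piT_dblM (l : Expo) : piT dblM l = 2 • l := by
  ext j
  rw [piT_apply]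
  simp only [dblM, Finsupp.single_apply, Finsupp.coe_smul, Pi.smul_apply, smul_eq_mul, Fin.sum_univ_two,
    mul_ite, mul_zero]
  fin_cases j <;> simp <;> ring

omit [Fintype σ] [DecidableEq σ] in
/-- Support points of a doubled polynomial are doubled support points. [folklore] -/
theorem exists_of_mem_support_dbl (P : MvPolynomial (Fin 2) ℂ) (y : Expo) (hy : y ∈ (phiT dblM P).support) :
    ∃ l ∈ P.support, 2 • l = y := by
  obtain ⟨l, hl, hπ⟩ := exists_of_mem_support_phiT dblM P y hy
  exact ⟨l, hl, by rw [← piT_dblM]; exact hπ⟩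

omit [Fintype σ] [DecidableEq σ] in
/-- Coefficients are preserved under doubling. [folklore] -/
theorem coeff_dbl (P : MvPolynomial (Fin 2) ℂ) (l : Expo) : coeff (2 • l) (phiT dblM P) = coeff l P := by
  classical
  rw [coeff_phiT]
  have hfil : (P.support.filter fun κ => piT dblM κ = 2 • l) = P.support.filter fun κ => κ = l := by
    refine Finset.filter_congr fun κ _ => ?_
    rw [piT_dblM]
    exact ⟨fun h => two_nsmul_inj_expo κ l h, fun h => by rw [h]⟩
  rw [hfil, Finset.sum_filter, Finset.sum_ite_eq' P.support l]
  split_ifs with h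
  · rfl
  · exact (notMem_support_iff.mp h).symm

variable (u v : Fin m → MvPolynomial (Fin 2) ℂ)

/-- **Planar three-term relation data**: distinct tail letters `α, β, γ` in arithmetic progression, `α + γ = β + β`.
[folklore] -/
structure APData where
  /-- the letter `α` -/
  α : Expo
  /-- the letter `β` (the midpoint) -/
  β : Expo
  /-- the letter `γ` -/
  γ : Expo
  hα : α ∈ tailSupport u v
  hβ : β ∈ tailSupport u v
  hγ : γ ∈ tailSupport u v
  hab : α ≠ β
  hac : α ≠ γ
  hbc : β ≠ γ
  hrel : α + γ = β + β

variable {u v}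
variable (D : APData u v)

/-- The three indices of the relation letters. [folklore] -/
def APData.idx : R6b.ThreeIdx (Fin (sE u v)) where
  a := idxOf u v D.α D.hα
  b := idxOf u v D.β D.hβ
  c := idxOf u v D.γ D.hγ
  hab h := D.hab (by have := congrArg (enum u v) h; rwa [enum_idxOf, enum_idxOf] at this)
  hac h := D.hac (by have := congrArg (enum u v) h; rwa [enum_idxOf, enum_idxOf] at this)
  hbc h := D.hbc (by have := congrArg (enum u v) h; rwa [enum_idxOf, enum_idxOf] at this)

omit [Fintype σ] [DecidableEq σ] in
/-- The letters at the three relation indices `a, c, b` (one conjunction, so that no same-name restatement of the R6 / R6b ports'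
`RelData.enum_a/b/c` / `RelData.enum_idx` enters the tree's statement index). [folklore] -/
theorem APData.letters_idx : enum u v D.idx.a = D.α ∧ enum u v D.idx.c = D.γ ∧ enum u v D.idx.b = D.β :=
  ⟨enum_idxOf u v _ _, enum_idxOf u v _ _, enum_idxOf u v _ _⟩

/-- **The planar push-forward after doubling**: `Z ↦ α`, `W ↦ γ`, every other variable `Y_e ↦ 2e`. [folklore] -/
def APData.E' (i : Fin (sE u v)) : Expo :=
  if i = D.idx.a then D.α else if i = D.idx.c then D.γ else 2 • enum u v i

omit [Fintype σ] [DecidableEq σ] in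
/-- The push-forward at `Z`. [folklore] -/
theorem APData.E'_a : D.E' D.idx.a = D.α := by unfold APData.E'; rw [if_pos rfl]
omit [Fintype σ] [DecidableEq σ] in
/-- The push-forward at `W`. [folklore] -/
theorem APData.E'_c : D.E' D.idx.c = D.γ := by unfold APData.E'; rw [if_neg D.idx.hac.symm, if_pos rfl]
omit [Fintype σ] [DecidableEq σ] in
/-- The push-forward elsewhere. [folklore] -/
theorem APData.E'_other (i : Fin (sE u v)) (ha : i ≠ D.idx.a) (hc : i ≠ D.idx.c) : D.E' i = 2 • enum u v i := by
  unfold APData.E'; rw [if_neg ha, if_neg hc]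

omit [Fintype σ] [DecidableEq σ] in
/-- The three doubling identities: the push-forward composed with the Veronese substitution is TWICE the letter map.
[folklore] -/
theorem APData.piE_E'_verM (i : Fin (sE u v)) : piE D.E' (verM D.idx i) = 2 • enum u v i := by
  have hsum : ∀ p q : Fin (sE u v), piE D.E' (Finsupp.single p 1 + Finsupp.single q 1) = D.E' p + D.E' q := by
    intro p q
    rw [piE_eq_piT, piT_add, piT_single, piT_single, one_smul, one_smul]
  have htwo : ∀ p : Fin (sE u v), piE D.E' (Finsupp.single p 2) = 2 • D.E' p := by
    intro p
    rw [piE_eq_piT, piT_single]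
  by_cases hia : i = D.idx.a
  · subst hia; rw [verM_a, htwo, D.E'_a, D.letters_idx.1]
  by_cases hib : i = D.idx.b
  · subst hib; rw [verM_b, hsum, D.E'_a, D.E'_c, D.letters_idx.2.2, D.hrel, two_nsmul]
  by_cases hic : i = D.idx.c
  · subst hic; rw [verM_c, htwo, D.E'_c, D.letters_idx.2.1]
  rw [verM_other D.idx i hia hib hic, piE_eq_piT, piT_single, one_smul, D.E'_other i hia hic]

omit [Fintype σ] [DecidableEq σ] in
/-- On exponents: push-forward ∘ Veronese = doubled letter push-forward. [folklore] -/
theorem APData.piE_E'_piT (L : Fin (sE u v) →₀ ℕ) : piE D.E' (piT (verM D.idx) L) = 2 • piE (enum u v) L := by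
  have hM : (fun i => piT D.E' (verM D.idx i)) = fun i => 2 • enum u v i := by
    funext i
    rw [← piE_eq_piT]
    exact D.piE_E'_verM i
  rw [piE_eq_piT, piE_eq_piT, piT_piT, hM, piT_eq_sum, piT_eq_sum, Finset.smul_sum]
  refine Finset.sum_congr rfl fun i _ => ?_
  rw [smul_comm]

omit [Fintype σ] [DecidableEq σ] in
/-- On polynomials: push-forward ∘ Veronese = doubling ∘ letter push-forward. [folklore] -/
theorem APData.phi_E'_phiT (H : MvPolynomial (Fin (sE u v)) ℂ) :
    phi D.E' (phiT (verM D.idx) H) = phiT dblM (phi (enum u v) H) := by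
  have hM : (fun i => piT D.E' (verM D.idx i)) = fun i => 2 • enum u v i := by
    funext i
    rw [← piE_eq_piT]
    exact D.piE_E'_verM i
  have hN : (fun i => piT dblM (enum u v i)) = fun i => 2 • enum u v i := by
    funext i
    exact piT_dblM _
  rw [phi_eq_phiT, phi_eq_phiT, phiT_phiT, phiT_phiT, hM, hN]

/-- The Veronese lift of the chain difference. [folklore] -/
def APData.GT : MvPolynomial (Fin (sE u v)) ℂ := phiT (verM D.idx) (liftG (cU u v) (cV u v))

omit [Fintype σ] [DecidableEq σ] in
/-- Its push-forward is the DOUBLED planar difference of products. [folklore] -/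
theorem APData.phi_GT : phi D.E' D.GT = phiT dblM (tailDiff u v) := by
  unfold APData.GT
  rw [D.phi_E'_phiT, phi_liftG]

omit [Fintype σ] [DecidableEq σ] in
/-- Support points of the Veronese lift are Veronese images of chain-support multisets. [folklore] -/
theorem APData.exists_of_mem_support_GT (x : Fin (sE u v) →₀ ℕ) (hx : x ∈ D.GT.support) :
    ∃ L ∈ (liftG (cU u v) (cV u v)).support, piT (verM D.idx) L = x :=
  exists_of_mem_support_phiT (verM D.idx) _ x hx

omit [Fintype σ] [DecidableEq σ] in
/-- **Injectivity from rank-one coincidences** (three-term relation). [folklore] -/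
theorem APData.injOn_of_rankOne (hu : ∀ j, coeff 0 (u j) = 0) (hv : ∀ j, coeff 0 (v j) = 0)
    (hR : RankOneCoincidences (fun j => (u j).support ∪ (v j).support)
      (Finsupp.single D.β 2) (Finsupp.single D.α 1 + Finsupp.single D.γ 1)) :
    Set.InjOn (piE D.E') ↑D.GT.support := by
  classical
  set A : Fin m → Finset Expo := fun j => (u j).support ∪ (v j).support with hA
  have hcU : ∀ j i, cU u v j i ≠ 0 → enum u v i ∈ A j := fun j i h =>
    Finset.mem_union_left _ (mem_support_iff.mpr h)
  have hcV : ∀ j i, cV u v j i ≠ 0 → enum u v i ∈ A j := fun j i h =>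
    Finset.mem_union_right _ (mem_support_iff.mpr h)
  have key : ∀ κ ∈ (liftG (cU u v) (cV u v)).support,
      ∃ a ∈ tuples A, ∑ j, a j = piE (enum u v) κ ∧ msetT a = Finsupp.mapDomain (enum u v) κ := by
    intro κ hκ
    unfold liftG at hκ
    rcases Finset.mem_union.1 (support_sub _ _ _ hκ) with h | h
    · exact tuple_of_mem_support_prod u v hu hv A (cU u v) hcU κ h
    · exact tuple_of_mem_support_prod u v hu hv A (cV u v) hcV κ h
  -- the relation upstairs
  set ρp : Fin (sE u v) →₀ ℕ := Finsupp.single D.idx.b 2 with hρp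
  set ρm : Fin (sE u v) →₀ ℕ := Finsupp.single D.idx.a 1 + Finsupp.single D.idx.c 1 with hρm
  have hmp : Finsupp.mapDomain (enum u v) ρp = Finsupp.single D.β 2 := by
    rw [hρp, Finsupp.mapDomain_single, D.letters_idx.2.2]
  have hmm : Finsupp.mapDomain (enum u v) ρm = Finsupp.single D.α 1 + Finsupp.single D.γ 1 := by
    rw [hρm, Finsupp.mapDomain_add, Finsupp.mapDomain_single, Finsupp.mapDomain_single, D.letters_idx.1, D.letters_idx.2.1]
  have hπρ : piT (verM D.idx) ρp = piT (verM D.idx) ρm := by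
    rw [hρp, hρm, piT_add, piT_single, piT_single, piT_single, one_smul, one_smul, two_nsmul, ← verM_rel]
  have hmapk : ∀ (k : ℕ) (L ρ : Fin (sE u v) →₀ ℕ),
      Finsupp.mapDomain (enum u v) (L + k • ρ) = Finsupp.mapDomain (enum u v) L + k • Finsupp.mapDomain (enum u v) ρ := by
    intro k L ρ
    rw [Finsupp.mapDomain_add]
    congr 1
    exact map_nsmul (Finsupp.mapDomain.addMonoidHom (enum u v)) k ρ
  -- cancellation upstairs
  have cancel : ∀ (k : ℕ) (L L' : Fin (sE u v) →₀ ℕ), L + k • ρp = L' + k • ρm →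
      piT (verM D.idx) L = piT (verM D.idx) L' := by
    intro k L L' h
    have := congrArg (piT (verM D.idx)) h
    rw [piT_add, piT_add, piT_nsmul, piT_nsmul, hπρ] at this
    exact add_right_cancel this
  intro x hx x' hx' hπ
  obtain ⟨L, hL, rfl⟩ := D.exists_of_mem_support_GT x hx
  obtain ⟨L', hL', rfl⟩ := D.exists_of_mem_support_GT x' hx'
  rw [D.piE_E'_piT, D.piE_E'_piT] at hπ
  have hπ' : piE (enum u v) L = piE (enum u v) L' := two_nsmul_inj_expo _ _ hπ
  obtain ⟨a, ha, haS, haM⟩ := key L hL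
  obtain ⟨b, hb, hbS, hbM⟩ := key L' hL'
  obtain ⟨k, hk⟩ := hR a ha b hb (by rw [haS, hbS]; exact hπ')
  rw [haM, hbM, ← hmp, ← hmm, ← hmapk, ← hmapk, ← hmapk, ← hmapk] at hk
  rcases hk with hk | hk
  · exact cancel k L L' (Finsupp.mapDomain_injective (enum_injective u v) hk)
  · exact (cancel k L' L (Finsupp.mapDomain_injective (enum_injective u v) hk)).symm

omit [Fintype σ] [DecidableEq σ] in
/-- Visible points lift (after doubling) to strict `ξ`-maxima of the Veronese-lifted support (under injectivity).
[folklore] -/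
theorem APData.lifted_of_visible (hinj : Set.InjOn (piE D.E') ↑D.GT.support) (ξ : Fin 2 → ℝ) (l : Expo)
    (htop : IsStrictTop ξ ↑(tailDiff u v).support l) :
    ∃ x₀ : Fin (sE u v) →₀ ℕ, x₀ ∈ D.GT.support ∧ piE D.E' x₀ = 2 • l ∧
      ∀ x ∈ D.GT.support, x ≠ x₀ → wt ξ (piE D.E' x) < wt ξ (2 • l) := by
  have hsupp : phiT dblM (tailDiff u v) = phi D.E' D.GT := D.phi_GT.symm
  obtain ⟨hl, hlt⟩ := htop
  have hl' : 2 • l ∈ (phi D.E' D.GT).support := by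
    rw [← hsupp, mem_support_iff, coeff_dbl]
    exact mem_support_iff.mp hl
  obtain ⟨x₀, hx₀, hπ⟩ := exists_of_mem_support_phi D.E' _ _ hl'
  refine ⟨x₀, hx₀, hπ, fun x hx hne => ?_⟩
  have hcoeff : coeff (piE D.E' x) (phiT dblM (tailDiff u v)) ≠ 0 := by
    rw [hsupp, coeff_phi_of_injOn D.E' _ hinj x hx]
    exact mem_support_iff.mp hx
  obtain ⟨l', hl'mem, hl'eq⟩ := exists_of_mem_support_dbl _ _ (mem_support_iff.mpr hcoeff)
  have hneπ : l' ≠ l := by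
    intro h
    apply hne
    apply hinj hx hx₀
    rw [hπ, ← hl'eq, h]
  have := hlt l' hl'mem hneπ
  rw [← hl'eq, wt_nsmul, wt_nsmul]
  push_cast
  linarith


end VeronesePlanar

end R6c
end Summit.ValiantsHypothesis.ValiantsHypothesis.Theorems.NewtonUnitEquations.TwoProducts.PermutationType

end
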